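import Mathlib
import Literature.NumberTheory.Automorphic.HyperbolicLaplaceSpectrum

/-!
# Invariance of the hyperbolic Laplacian and the eigenfunctions `(Im z)^s`
(Iwaniec, *Spectral Methods of Automorphic Forms*, GSM 53, §1.6–§1.7: (1.19), the invariance of `Δ`,
and (1.22)–(1.23), PDF pp. 16–17)

Tenth layer (part a) of the `provefact` decomposition of `Literature.NumberTheory.Automorphic.sl2BallCount_asymp`, and the first
brick of the spectral theory of `L²(SL₂(ℤ)\ℍ)` behind the remaining named fact
`Iwaniec2002_thm_7_4_modular` (`ModularPretrace.lean`): the Laplace operator `Δ = y²(∂²ₓ + ∂²ᵧ)`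
of `HyperbolicLaplaceSpectrum.lean` (`hypLaplacian`, normalisation (1.19)) commutes with the
action of `GL₂⁺(ℝ)` on `ℍ` (§1.6, PDF p. 16: "`L(f(gz)) = (Lf)(gz)` ... Check directly that `Δ` is
invariant" — unnumbered), and `y^s` — hence every `(Im γz)^s`, the general term of Eisenstein and
Poincaré series — satisfies `(Δ + λ) y^s = 0` with `λ = s(1 - s)` ((1.22)–(1.23), PDF pp. 16–17).
Everything here is proved; nothing is vendored. ((1.20)–(1.21) of the book are `Δ` in geodesic
polar and in `u`-coordinates; they are not used here.)

1. `ConformalLaplacian.laplacian_comp_holomorphic` (Mathlib's Euclidean Laplacian on `ℂ`): for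
   `φ` holomorphic near `z` and `F` of class `C²` at `φ z`,
   `Δₑ(F ∘ φ)(z) = |φ'(z)|² (ΔₑF)(φ z)` — the second-order chain rule
   `D²(F ∘ φ)[v, v] = D²F[φ'v, φ'v] + DF[φ''v²]`, the algebraic identity
   `B(c, c) + B(ci, ci) = |c|²(B(1,1) + B(i,i))` for `ℝ`-bilinear `B`, and `1 + i² = 0`.
2. The action of `g ∈ GL₂⁺(ℝ)` extended to `ℂ` is Mathlib's `z ↦ ↑(g • ofComplex z)`
   (`Mathlib/Analysis/Complex/UpperHalfPlane/Manifold.lean`: `UpperHalfPlane.analyticAt_smul`,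
   `hasStrictDerivAt_smul`, `deriv_smul` `= det g/(cz + d)²`, `deriv_smul_ne_zero`, all under
   `0 < det g` at points of `ℍ`); pulling back `f : ℍ → ℂ` along `g` and extending by `ofComplex`
   is literally `(f ∘ ofComplex) ∘ (z ↦ ↑(g • ofComplex z))` (`comp_smul_extend_eq`, a `funext`).
3. **`hypLaplacian_comp_smul`**: `Δ(f ∘ g)(z) = (Δf)(gz)` for `det g > 0` and `f` of class `C²`
   at `gz` (from 1–2 and `Im gz = det g · Im z/|cz + d|²`); consequences: `C²` is preserved
   (`IsC2.comp_smul`) and `Δ` of a `C²` automorphic function is automorphic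
   (`isAutomorphic_hypLaplacian`).
4. **`hypLaplacian_im_cpow`**: `Δ y^s + s(1 - s) y^s = 0` for every `s ∈ ℂ` (`y^s = (Im z : ℂ)^s`),
   via `Δₑ (Im w)^s = s(s-1)(Im w)^{s-2}`; and **`hypLaplacian_im_smul_cpow`**:
   `(Δ + s(1 - s))(Im g·)^s = 0` for `det g > 0`.

Mathlib: `InnerProductSpace.laplacian_eq_iteratedFDeriv_complexPlane`, `iteratedFDeriv_two_apply`,
`HasFDerivAt.clm_comp`, `ContinuousLinearMap.iteratedFDerivWithin_comp_right`,
`HasDerivAt.cpow_const`; the `GL₂(ℝ)`-action `UpperHalfPlane.glAction` with `num`/`denom`, its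
`ℂ`-extension lemmas `UpperHalfPlane.analyticAt_smul`/`deriv_smul` and `im_smul_eq_div_normSq`,
`coe_smul_of_det_pos`. No conformal-invariance lemma for the Laplacian exists in Mathlib or
Literature (`lean search 'laplacian.*comp|conformal.*laplacian'`: only `comp_left` by `CLM`/`CLE`;
`Literature/Geometry/Conformal/MoebiusSphere.lean` treats Möbius maps of spheres, not the Laplacian).
-/

noncomputable section

namespace Literature.NumberTheory.Automorphic

open Filter Topology Complex InnerProductSpace Laplacian ContinuousLinearMap

/-! ## 1. Conformal invariance of the Euclidean Laplacian on `ℂ` -/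

namespace ConformalLaplacian

variable {E : Type*} [NormedAddCommGroup E] [NormedSpace ℝ E]

/-- The algebraic identity behind conformal invariance, in coordinates: for an `ℝ`-bilinear map
`B` on `ℂ` and `a, b ∈ ℝ`, `c = a + bi`: `B(c, c) + B(ci, ci) = (a² + b²)(B(1,1) + B(i,i))`. [folklore] -/
theorem bilin_conformal_aux (B : ℂ →L[ℝ] ℂ →L[ℝ] E) (a b : ℝ) :
    B (a • (1 : ℂ) + b • I) (a • (1 : ℂ) + b • I) + B ((-b) • (1 : ℂ) + a • I) ((-b) • (1 : ℂ) + a • I) =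
      (a ^ 2 + b ^ 2) • (B 1 1 + B I I) := by
  simp only [map_add, map_smul, add_apply, smul_apply, map_neg, neg_apply, smul_add, smul_smul,
    add_smul, smul_neg, neg_smul]
  module

/-- The algebraic identity behind conformal invariance: for an `ℝ`-bilinear map `B` on `ℂ` and
`c ∈ ℂ`, `B(c, c) + B(ci, ci) = |c|² (B(1,1) + B(i,i))`. [folklore] -/
theorem bilin_conformal (B : ℂ →L[ℝ] ℂ →L[ℝ] E) (c : ℂ) :
    B c c + B (c * I) (c * I) = (‖c‖ ^ 2) • (B 1 1 + B I I) := by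
  have hc : c = c.re • (1 : ℂ) + c.im • I := by
    rw [real_smul, real_smul, mul_one]; exact (re_add_im c).symm
  have hci : c * I = (-c.im) • (1 : ℂ) + c.re • I := by
    rw [real_smul, real_smul, mul_one]
    apply Complex.ext <;> simp
  have hn : ‖c‖ ^ 2 = c.re ^ 2 + c.im ^ 2 := by
    rw [← Complex.normSq_eq_norm_sq, Complex.normSq_apply]; ring
  have key := bilin_conformal_aux B c.re c.im
  rw [← hc, ← hci] at key
  rw [key, hn]

/-- The real Fréchet derivative of a holomorphic function is multiplication by its complex
derivative. [folklore] -/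
theorem fderiv_real_of_holomorphic {φ : ℂ → ℂ} {w : ℂ} (h : DifferentiableAt ℂ φ w) (v : ℂ) :
    fderiv ℝ φ w v = v * deriv φ w := by
  have h1 : HasFDerivAt φ ((fderiv ℂ φ w).restrictScalars ℝ) w :=
    h.hasFDerivAt.restrictScalars ℝ
  have h2 := (fderiv ℂ φ w).map_smul v 1
  simp only [smul_eq_mul, mul_one] at h2
  rw [h1.fderiv, ContinuousLinearMap.coe_restrictScalars', h2, fderiv_apply_one_eq_deriv]

/-- For `φ` holomorphic on a neighbourhood of `z`: the real derivative `w ↦ Dφ(w)` has derivative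
`v ↦ (u ↦ u · v · φ''(z))` at `z`. [folklore] -/
theorem hasFDerivAt_fderiv_real_of_holomorphic {φ : ℂ → ℂ} {z : ℂ}
    (h : ∀ᶠ w in 𝓝 z, DifferentiableAt ℂ φ w) :
    HasFDerivAt (fun w => fderiv ℝ φ w)
      (((ContinuousLinearMap.mul ℝ ℂ).flip : ℂ →L[ℝ] ℂ →L[ℝ] ℂ).comp
        ((ContinuousLinearMap.mul ℝ ℂ).flip (deriv (deriv φ) z))) z := by
  -- `fderiv ℝ φ w = mul.flip (deriv φ w)` near `z`
  have heq : (fun w => fderiv ℝ φ w) =ᶠ[𝓝 z]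
      fun w => ((ContinuousLinearMap.mul ℝ ℂ).flip : ℂ →L[ℝ] ℂ →L[ℝ] ℂ) (deriv φ w) := by
    filter_upwards [h] with w hw
    ext v
    rw [fderiv_real_of_holomorphic hw, ContinuousLinearMap.flip_apply, ContinuousLinearMap.mul_apply']
  -- `deriv φ` is holomorphic near `z`
  have hd : DifferentiableAt ℂ (deriv φ) z := by
    obtain ⟨U, hU, hUo, hzU⟩ : ∃ U : Set ℂ, (∀ w ∈ U, DifferentiableAt ℂ φ w) ∧ IsOpen U ∧ z ∈ U := by
      obtain ⟨U, hU, hUo, hzU⟩ := eventually_nhds_iff.mp h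
      exact ⟨U, hU, hUo, hzU⟩
    have hφU : DifferentiableOn ℂ φ U := fun w hw => (hU w hw).differentiableWithinAt
    exact ((hφU.analyticOnNhd hUo).deriv z hzU).differentiableAt
  have hd' : HasFDerivAt (deriv φ) ((ContinuousLinearMap.mul ℝ ℂ).flip (deriv (deriv φ) z)) z := by
    have h1 : HasFDerivAt (deriv φ) ((fderiv ℂ (deriv φ) z).restrictScalars ℝ) z :=
      hd.hasFDerivAt.restrictScalars ℝ
    convert h1 using 1
    ext v
    simp only [ContinuousLinearMap.flip_apply, ContinuousLinearMap.mul_apply',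
      ContinuousLinearMap.coe_restrictScalars']
    have h2 := (fderiv ℂ (deriv φ) z).map_smul v 1
    simp only [smul_eq_mul, mul_one] at h2
    rw [h2, fderiv_apply_one_eq_deriv]
  refine HasFDerivAt.congr_of_eventuallyEq ?_ heq
  exact (((ContinuousLinearMap.mul ℝ ℂ).flip : ℂ →L[ℝ] ℂ →L[ℝ] ℂ).hasFDerivAt).comp z hd'

/-- **Conformal invariance of the planar Laplacian.** If `φ` is holomorphic on a neighbourhood of
`z` and `F` is `C²` at `φ z`, then `Δ(F ∘ φ)(z) = |φ'(z)|² · (ΔF)(φ z)`. (Second-order chain rule: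
`D²(F∘φ)[v,v] = D²F[φ'v, φ'v] + DF[φ'' v²]`; the first terms over `v = 1, i` give `|φ'|² ΔF` since
`{φ', iφ'}` is a conformal frame, the second vanish as `1 + i² = 0`.) [folklore] -/
theorem laplacian_comp_holomorphic {F : ℂ → E} {φ : ℂ → ℂ} {z : ℂ}
    (hφ : ∀ᶠ w in 𝓝 z, DifferentiableAt ℂ φ w) (hF : ContDiffAt ℝ 2 F (φ z)) :
    Δ (F ∘ φ) z = (‖deriv φ z‖ ^ 2) • Δ F (φ z) := by
  -- derivatives of `F` near `φ z`
  have hF1 : ∀ᶠ y in 𝓝 (φ z), HasFDerivAt F (fderiv ℝ F y) y := by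
    filter_upwards [hF.eventually (by simp)] with y hy
    exact (hy.differentiableAt (by simp)).hasFDerivAt
  have hFF : HasFDerivAt (fderiv ℝ F) (fderiv ℝ (fderiv ℝ F) (φ z)) (φ z) :=
    ((hF.fderiv_right (m := 1) (by norm_num)).differentiableAt (by simp)).hasFDerivAt
  -- derivatives of `φ` near `z`
  have hφz : DifferentiableAt ℂ φ z := hφ.self_of_nhds
  have hφ1 : ∀ᶠ w in 𝓝 z, HasFDerivAt φ (fderiv ℝ φ w) w := by
    filter_upwards [hφ] with w hw
    exact (hw.restrictScalars ℝ).hasFDerivAt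
  have hφφ := hasFDerivAt_fderiv_real_of_holomorphic hφ
  -- first derivative of the composition near `z`
  have hcomp : (fun w => fderiv ℝ (F ∘ φ) w) =ᶠ[𝓝 z]
      fun w => (fderiv ℝ F (φ w)).comp (fderiv ℝ φ w) := by
    have hF1' : ∀ᶠ w in 𝓝 z, HasFDerivAt F (fderiv ℝ F (φ w)) (φ w) :=
      hφz.continuousAt.eventually hF1
    filter_upwards [hF1', hφ1] with w hwF hwφ
    exact (hwF.comp w hwφ).fderiv
  -- second derivative of the composition at `z`
  have hc : HasFDerivAt (fun w => fderiv ℝ F (φ w))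
      ((fderiv ℝ (fderiv ℝ F) (φ z)).comp (fderiv ℝ φ z)) z :=
    HasFDerivAt.comp z hFF (hφz.restrictScalars ℝ).hasFDerivAt
  have hL := hc.clm_comp hφφ
  have h2 : fderiv ℝ (fderiv ℝ (F ∘ φ)) z = fderiv ℝ (fun w => (fderiv ℝ F (φ w)).comp (fderiv ℝ φ w)) z :=
    Filter.EventuallyEq.fderiv_eq hcomp
  -- evaluate both Laplacians
  simp only [laplacian_eq_iteratedFDeriv_complexPlane, iteratedFDeriv_two_apply, Fin.isValue,
    Matrix.cons_val_zero, Matrix.cons_val_one, Matrix.cons_val_fin_one]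
  rw [h2, hL.fderiv]
  set B : ℂ →L[ℝ] ℂ →L[ℝ] E := fderiv ℝ (fderiv ℝ F) (φ z) with hB
  set c : ℂ := deriv φ z with hcdef
  have hDφ : ∀ v : ℂ, fderiv ℝ φ z v = v * c := fun v => fderiv_real_of_holomorphic hφz v
  have hev : ∀ v : ℂ,
      ((compL ℝ ℂ ℂ E (fderiv ℝ F (φ z))).comp
          ((((ContinuousLinearMap.mul ℝ ℂ).flip : ℂ →L[ℝ] ℂ →L[ℝ] ℂ).comp
            ((ContinuousLinearMap.mul ℝ ℂ).flip (deriv (deriv φ) z)))) +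
        ((compL ℝ ℂ ℂ E).flip (fderiv ℝ φ z)).comp ((fderiv ℝ (fderiv ℝ F) (φ z)).comp (fderiv ℝ φ z)))
        v v =
      fderiv ℝ F (φ z) (v * (v * deriv (deriv φ) z)) + B (v * c) (v * c) := by
    intro v
    simp only [add_apply, ContinuousLinearMap.comp_apply, compL_apply,
      ContinuousLinearMap.flip_apply, ContinuousLinearMap.mul_apply', hDφ, hB]
  rw [hev 1, hev I]
  simp only [one_mul]
  rw [show I * c = c * I by ring]
  have hsum : fderiv ℝ F (φ z) (deriv (deriv φ) z) +
      fderiv ℝ F (φ z) (I * (I * deriv (deriv φ) z)) = 0 := by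
    rw [← map_add, show deriv (deriv φ) z + I * (I * deriv (deriv φ) z) = 0 by
      ring_nf; rw [I_sq]; ring, map_zero]
  have hkey := bilin_conformal B c
  calc fderiv ℝ F (φ z) (deriv (deriv φ) z) + B c c +
        (fderiv ℝ F (φ z) (I * (I * deriv (deriv φ) z)) + B (c * I) (c * I))
      = (fderiv ℝ F (φ z) (deriv (deriv φ) z) +
          fderiv ℝ F (φ z) (I * (I * deriv (deriv φ) z))) + (B c c + B (c * I) (c * I)) := by abel
    _ = (‖c‖ ^ 2) • (B 1 1 + B I I) := by rw [hsum, zero_add, hkey]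

end ConformalLaplacian

/-! ## 2. The invariance of `Δ` under `GL₂⁺(ℝ)` -/


open UpperHalfPlane MeasureTheory
open scoped MatrixGroups

variable {g : GL (Fin 2) ℝ}

/-- Pulling `f : ℍ → ℂ` back along the action of `g` and extending to `ℂ` by `ofComplex` is
extending `f` and composing with Mathlib's `ℂ`-extension `z ↦ ↑(g • ofComplex z)` of the action
(an identity of functions on all of `ℂ`, since `ofComplex ↑w = w`). [folklore] -/
theorem comp_smul_extend_eq (g : GL (Fin 2) ℝ) (f : ℍ → ℂ) :
    ((fun w : ℍ => f (g • w)) ∘ ofComplex : ℂ → ℂ) =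
      (f ∘ ofComplex : ℂ → ℂ) ∘ fun z : ℂ => ((g • ofComplex z : ℍ) : ℂ) := by
  funext w
  simp only [Function.comp_apply, ofComplex_apply]

/-- For `det g > 0`, the `ℂ`-extension `z ↦ ↑(g • ofComplex z)` is holomorphic at every point near a
point of `ℍ` (Mathlib's `UpperHalfPlane.analyticAt_smul` on the open upper half-plane). [folklore] -/
theorem eventually_differentiableAt_smul_extend (hg : 0 < g.det.val) (z : ℍ) :
    ∀ᶠ w in 𝓝 (z : ℂ), DifferentiableAt ℂ (fun z : ℂ => ((g • ofComplex z : ℍ) : ℂ)) w := by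
  filter_upwards [isOpen_upperHalfPlaneSet.mem_nhds z.im_pos] with w hw
  exact (analyticAt_smul hg ⟨w, hw⟩).differentiableAt

/-- **Invariance of the hyperbolic Laplacian** (`Δ` commutes with the action of `GL₂⁺(ℝ)`,
`L(f(gz)) = (Lf)(gz)`): for `det g > 0` and `f` of class `C²` at `g z`,
`Δ(f ∘ g)(z) = (Δ f)(g z)`. Proof: conformal invariance of the Euclidean Laplacian,
`Δ_e(F ∘ φ_g) = |φ_g'|² (Δ_e F) ∘ φ_g` with `φ_g' = det g/(cz + d)²` (`UpperHalfPlane.deriv_smul`),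
and `Im(g z) = det g · Im z / |cz + d|²`.
[cite: Iwaniec2002, §1.6 (invariance of Δ: "check directly that Δ is invariant"), PDF p. 16] -/
theorem hypLaplacian_comp_smul (hg : 0 < g.det.val) (f : ℍ → ℂ) (z : ℍ)
    (hf : ContDiffAt ℝ 2 (f ∘ ofComplex : ℂ → ℂ) ((g • z : ℍ) : ℂ)) :
    hypLaplacian (fun w => f (g • w)) z = hypLaplacian f (g • z) := by
  unfold hypLaplacian
  have hg' : 0 < g.val.det := hg
  have hφz : (fun z : ℂ => ((g • ofComplex z : ℍ) : ℂ)) (z : ℂ) = ((g • z : ℍ) : ℂ) := by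
    simp only [ofComplex_apply]
  rw [← hφz] at hf
  rw [comp_smul_extend_eq, ConformalLaplacian.laplacian_comp_holomorphic
    (eventually_differentiableAt_smul_extend hg z) hf, deriv_smul hg' z, ofComplex_apply]
  -- the conformal factors
  rw [UpperHalfPlane.im_smul_eq_div_normSq, abs_of_pos hg]
  have hd : denom g z ≠ 0 := denom_ne_zero g z
  have hn : Complex.normSq (denom g z) ≠ 0 := by rwa [Ne, Complex.normSq_eq_zero]
  rw [norm_div, norm_pow, Complex.norm_real, Real.norm_of_nonneg hg'.le, Complex.real_smul]
  rw [show (g.val.det : ℝ) = g.det.val from rfl]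
  rw [← mul_assoc]
  congr 1
  have e : ‖denom g z‖ ^ 2 = Complex.normSq (denom g z) := (Complex.normSq_eq_norm_sq _).symm
  push_cast
  rw [show (‖denom g z‖ : ℂ) ^ 2 = (Complex.normSq (denom g z) : ℂ) by exact_mod_cast e]
  field_simp

/-! ## 3. `Δ y^s = s(s-1) y^s`: the eigenfunctions `(Im z)^s` and `(Im g z)^s` -/

section PowIm

open Set

variable (s : ℂ)

/-- `t ↦ (t : ℂ)^s` has derivative `s t^{s-1}` at `t > 0`. [folklore] -/
theorem hasDerivAt_ofReal_cpow {t : ℝ} (ht : 0 < t) (c : ℂ) :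
    HasDerivAt (fun t : ℝ => (t : ℂ) ^ c) (c * (t : ℂ) ^ (c - 1)) t := by
  have h := ((hasDerivAt_id (t : ℂ)).cpow_const (c := c)
    (Complex.ofReal_mem_slitPlane.mpr ht)).comp_ofReal
  simpa using h

/-- `t ↦ (t : ℂ)^s` is `C^∞` at `t > 0`. [folklore] -/
theorem contDiffAt_ofReal_cpow {t : ℝ} (ht : 0 < t) (n : ℕ∞) :
    ContDiffAt ℝ n (fun t : ℝ => (t : ℂ) ^ s) t := by
  have h1 : AnalyticAt ℂ (fun w : ℂ => w ^ s) (t : ℂ) :=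
    analyticAt_id.cpow analyticAt_const (Complex.ofReal_mem_slitPlane.mpr ht)
  have h2 : ContDiffAt ℝ n (fun w : ℂ => w ^ s) (t : ℂ) := (h1.contDiffAt.restrict_scalars ℝ).of_le le_top
  exact h2.comp t (Complex.ofRealCLM.contDiff.contDiffAt)

/-- The second derivative: `(t^s)'' = s(s-1) t^{s-2}` for `t > 0`. [folklore] -/
theorem iteratedDeriv_two_ofReal_cpow {t : ℝ} (ht : 0 < t) :
    iteratedDeriv 2 (fun t : ℝ => (t : ℂ) ^ s) t = s * (s - 1) * (t : ℂ) ^ (s - 2) := by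
  rw [iteratedDeriv_succ, iteratedDeriv_one]
  have h1 : deriv (fun t : ℝ => (t : ℂ) ^ s) =ᶠ[𝓝 t] fun t : ℝ => s * (t : ℂ) ^ (s - 1) := by
    filter_upwards [isOpen_Ioi.mem_nhds ht] with u hu
    exact (hasDerivAt_ofReal_cpow hu s).deriv
  rw [h1.deriv_eq]
  have h2 : HasDerivAt (fun t : ℝ => s * (t : ℂ) ^ (s - 1)) (s * ((s - 1) * (t : ℂ) ^ (s - 1 - 1))) t :=
    (hasDerivAt_ofReal_cpow ht (s - 1)).const_mul s
  rw [h2.deriv, show s - 1 - 1 = s - 2 by ring]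
  ring

/-- The Euclidean Laplacian of `w ↦ (Im w)^s` at a point of the upper half-plane:
`Δ_e (Im w)^s = s(s-1)(Im w)^{s-2}`. [folklore] -/
theorem laplacian_im_cpow {z : ℂ} (hz : 0 < z.im) :
    Δ (fun w : ℂ => ((w.im : ℂ)) ^ s) z = s * (s - 1) * (z.im : ℂ) ^ (s - 2) := by
  set G : ℝ → ℂ := fun t => (t : ℂ) ^ s with hG
  set U : Set ℂ := {w : ℂ | 0 < w.im} with hU
  have hUo : IsOpen U := isOpen_upperHalfPlaneSet
  have hpre : (Complex.imCLM : ℂ →L[ℝ] ℝ) ⁻¹' Ioi 0 = U := by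
    ext w; simp [hU]
  have hGc : ContDiffOn ℝ 2 G (Ioi 0) := fun t ht =>
    (contDiffAt_ofReal_cpow s ht 2).contDiffWithinAt
  have hF : (fun w : ℂ => ((w.im : ℂ)) ^ s) = G ∘ (Complex.imCLM : ℂ →L[ℝ] ℝ) := by
    ext w; simp [hG]
  rw [laplacian_eq_iteratedFDeriv_complexPlane]
  simp only
  rw [hF, ← iteratedFDerivWithin_of_isOpen 2 hUo (show z ∈ U from hz), ← hpre,
    ContinuousLinearMap.iteratedFDerivWithin_comp_right _ hGc (uniqueDiffOn_Ioi 0)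
      (by rw [hpre]; exact hUo.uniqueDiffOn) (show Complex.imCLM z ∈ Ioi 0 from hz) le_rfl]
  simp only [ContinuousMultilinearMap.compContinuousLinearMap_apply,
    iteratedFDerivWithin_apply_eq_iteratedDerivWithin_mul_prod, Fin.prod_univ_two,
    Matrix.cons_val_zero, Matrix.cons_val_one, Matrix.cons_val_fin_one, Complex.imCLM_apply,
    Complex.one_im, Complex.I_im, mul_zero, zero_smul, zero_add, mul_one, one_smul]
  rw [iteratedDerivWithin_of_isOpen isOpen_Ioi (show z.im ∈ Ioi 0 from hz),
    iteratedDeriv_two_ofReal_cpow s hz]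

variable {s}

/-- `hypLaplacian (Im ·)^s = s(s-1) (Im ·)^s`, i.e. `(Δ + λ) y^s = 0` with `λ = s(1 - s)` in the
normalisation (1.19): `y^s` is an eigenfunction of the hyperbolic Laplacian ((1.22)) with eigenvalue
`λ = s(1 - s)` ((1.23): "where `s(1 - s) = λ`"). [cite: Iwaniec2002, (1.22)–(1.23), PDF pp. 16–17] -/
theorem hypLaplacian_im_cpow (s : ℂ) (z : ℍ) :
    hypLaplacian (fun w : ℍ => ((w.im : ℂ)) ^ s) z + s * (1 - s) * ((z.im : ℂ)) ^ s = 0 := by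
  unfold hypLaplacian
  have heq : ((fun w : ℍ => ((w.im : ℂ)) ^ s) ∘ ofComplex : ℂ → ℂ) =ᶠ[𝓝 (z : ℂ)]
      fun w : ℂ => ((w.im : ℂ)) ^ s := by
    filter_upwards [isOpen_upperHalfPlaneSet.mem_nhds z.im_pos] with w hw
    have hw' : 0 < w.im := hw
    simp only [Function.comp_apply]
    rw [ofComplex_apply_of_im_pos hw']
    rfl
  rw [(laplacian_congr_nhds heq).self_of_nhds, laplacian_im_cpow s z.im_pos]
  have hy : ((z.im : ℂ)) ≠ 0 := Complex.ofReal_ne_zero.mpr z.im_ne_zero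
  have e : ((z.im : ℂ)) ^ s = ((z.im : ℂ)) ^ (2 : ℂ) * ((z.im : ℂ)) ^ (s - 2) := by
    rw [← Complex.cpow_add _ _ hy]; ring_nf
  rw [UpperHalfPlane.coe_im, e, show ((z.im : ℂ)) ^ (2 : ℂ) = ((z.im : ℂ)) ^ 2 from Complex.cpow_two _]
  ring

/-- `(Im ·)^s` extended to `ℂ` is `C²` at every point of the upper half-plane. [folklore] -/
theorem contDiffAt_im_cpow_extend (s : ℂ) (z : ℍ) :
    ContDiffAt ℝ 2 ((fun w : ℍ => ((w.im : ℂ)) ^ s) ∘ ofComplex : ℂ → ℂ) (z : ℂ) := by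
  have heq : ((fun w : ℍ => ((w.im : ℂ)) ^ s) ∘ ofComplex : ℂ → ℂ) =ᶠ[𝓝 (z : ℂ)]
      fun w : ℂ => ((w.im : ℂ)) ^ s := by
    filter_upwards [isOpen_upperHalfPlaneSet.mem_nhds z.im_pos] with w hw
    have hw' : 0 < w.im := hw
    simp only [Function.comp_apply]
    rw [ofComplex_apply_of_im_pos hw']
    rfl
  refine ContDiffAt.congr_of_eventuallyEq ?_ heq
  have h1 : ContDiffAt ℝ 2 (fun t : ℝ => (t : ℂ) ^ s) z.im := contDiffAt_ofReal_cpow s z.im_pos 2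
  exact h1.comp (z : ℂ) (Complex.imCLM.contDiff.contDiffAt)

/-- **`(Im g z)^s` is an eigenfunction**: for `det g > 0`,
`(Δ + s(1-s)) (Im (g ·))^s = 0` — invariance of `Δ` applied to `y^s`. This is the eigen-equation of
every term of an Eisenstein or Poincaré series.
[cite: Iwaniec2002, §1.6 (invariance of Δ) with (1.22)–(1.23), PDF pp. 16–17] -/
theorem hypLaplacian_im_smul_cpow (hg : 0 < g.det.val) (s : ℂ) (z : ℍ) :
    hypLaplacian (fun w : ℍ => (((g • w).im : ℂ)) ^ s) z + s * (1 - s) * (((g • z).im : ℂ)) ^ s = 0 := by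
  have h := hypLaplacian_comp_smul hg (fun w : ℍ => ((w.im : ℂ)) ^ s) z (contDiffAt_im_cpow_extend s (g • z))
  rw [h]
  exact hypLaplacian_im_cpow s (g • z)

end PowIm


/-! ## 4. Consequences: `C²` and automorphy are compatible with `Δ` -/

section Consequences

open UpperHalfPlane
open scoped MatrixGroups

variable {g : GL (Fin 2) ℝ}

/-- **`C²` is preserved by the action of `GL₂⁺(ℝ)`**: `f ∘ g` is `C²` on `ℍ` if `f` is (the
`ℂ`-extension of the action is real-analytic at points of `ℍ`, `UpperHalfPlane.analyticAt_smul`).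
[folklore] -/
theorem IsC2.comp_smul (hg : 0 < g.det.val) {f : ℍ → ℂ} (hf : IsC2 f) :
    IsC2 (fun w : ℍ => f (g • w)) := by
  intro w hw
  have hw' : 0 < w.im := hw
  have hg' : 0 < g.val.det := hg
  have hF : ContDiffAt ℝ 2 (f ∘ ofComplex : ℂ → ℂ)
      ((fun z : ℂ => ((g • ofComplex z : ℍ) : ℂ)) w) :=
    hf.contDiffAt (isOpen_upperHalfPlaneSet.mem_nhds (g • ofComplex w).im_pos)
  have hφ : ContDiffAt ℝ 2 (fun z : ℂ => ((g • ofComplex z : ℍ) : ℂ)) w :=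
    ((analyticAt_smul hg' ⟨w, hw'⟩).contDiffAt.restrict_scalars ℝ).of_le le_top
  rw [comp_smul_extend_eq]
  exact (hF.comp w hφ).contDiffWithinAt

/-- Elements of the image of `SL₂(ℝ)` in `GL₂(ℝ)` have determinant `1 > 0`. [folklore] -/
theorem det_pos_of_mem_range_toGL {γ : GL (Fin 2) ℝ}
    (hγ : γ ∈ (Matrix.SpecialLinearGroup.toGL : SL(2, ℝ) →* GL (Fin 2) ℝ).range) :
    0 < γ.det.val := by
  obtain ⟨g, rfl⟩ := hγ
  simp

/-- **`Δ` of a `C²` automorphic function is automorphic** (for a group acting through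
`GL₂⁺(ℝ)`): `(Δf)(γz) = Δ(f ∘ γ)(z) = (Δf)(z)` — the invariance `L(f(gz)) = (Lf)(gz)` of §1.6.
[cite: Iwaniec2002, §1.6 (invariance of Δ), PDF p. 16] -/
theorem isAutomorphic_hypLaplacian {Γ : Subgroup (GL (Fin 2) ℝ)} (hΓ : ∀ γ ∈ Γ, 0 < γ.det.val)
    {f : ℍ → ℂ} (hf : IsAutomorphic Γ f) (hC : IsC2 f) : IsAutomorphic Γ (hypLaplacian f) := by
  intro γ hγ z
  have h1 : (fun w : ℍ => f (γ • w)) = f := funext (hf γ hγ)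
  have h2 := hypLaplacian_comp_smul (hΓ γ hγ) f z
    (hC.contDiffAt (isOpen_upperHalfPlaneSet.mem_nhds (γ • z).im_pos))
  rw [h1] at h2
  exact h2.symm

/-- The same for subgroups of (the image of) `SL₂(ℝ)`, e.g. the modular group `𝒮ℒ`.
[cite: Iwaniec2002, §1.6 (invariance of Δ), PDF p. 16] -/
theorem isAutomorphic_hypLaplacian_of_le_range {Γ : Subgroup (GL (Fin 2) ℝ)}
    (hΓ : Γ ≤ (Matrix.SpecialLinearGroup.toGL : SL(2, ℝ) →* GL (Fin 2) ℝ).range)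
    {f : ℍ → ℂ} (hf : IsAutomorphic Γ f) (hC : IsC2 f) : IsAutomorphic Γ (hypLaplacian f) :=
  isAutomorphic_hypLaplacian (fun _ hγ => det_pos_of_mem_range_toGL (hΓ hγ)) hf hC

end Consequences

end Literature.NumberTheory.Automorphic

end
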